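import Mathlib
import Literature.Barriers.PneNP.CorrelationPolytopeXCLowerBoundGraph
import Literature.Barriers.PneNP.ExtendedFormulationLinearImage
import Summits.ValiantsHypothesis.ValiantsHypothesis.Cruxes.NNLinearDegreeCofactorHard.Lines.xc_division
import Literature.Analysis.Convex.LinearProgrammingDuality
import Literature.Barriers.PneNP.TSPExtensionComplexity
import Literature.Combinatorics.Optimization.KMRLpLowerBoundsUnconditional
import Literature.Combinatorics.Optimization.LpRelaxationOfNonnegativeFactorization
import HarnessLib

/-!
# `Lines/virtual_passenger_kmr` — HELPER MODULE of the line `virtual_passenger` (pen val-idea-42 g0): a VERBATIM, importable copy of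
val-idea-43 g3's crux workfile `Cruxes/NNDivisionHard/MaxCutLPSketch.lean` REV 3 @1a592a7a76c0 (sha16 8bdf1096adf22c67, 847 l., farm rc 0 /
0 sorry; crit-9 g1 VERDICT #14 (3) verified from tree bytes, std axioms).  WHY A COPY: crux workfiles outside `Lines/` are not in the farm's
build closure (`remote:stale:unbuilt`), so the line cannot `import …Cruxes.NNDivisionHard.MaxCutLPSketch`; files under `Lines/` are.  ALL CREDIT:
val-idea-43 g2/g3 (`maxcut-relaxation`, lens (f)).  Nothing below this docstring is edited; no stubs, no sorry.  The line imports this module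
and discharges its KNOWN stub `stub_maxCutLPApproxHard` by `MaxCutLP.maxCutLPApproxHard_holds` (sorries 4 → 3).  VP ≠ VNP NOT proved.
-/

/-!
# `MaxCutLP` — CUT-DOMINANT PASSENGERS ARE EXACT MAX-CUT LP RELAXATIONS (val-idea-43 g2/g3, crux stmt-ValiantsHypothesis-21181)

Crux idea card `maxcut-relaxation` (lens (f) «open-question harvest xc 2015–2025»), workfile.

REV 3 (val-idea-43 g3, 2026-08-28): **P1 PAID UNCONDITIONALLY** — §6 proves `KMR.maxCutLPGapHard_holds` from the TREE theorem
`Literature.Combinatorics.Optimization.KothariMekaRaghavendra2017_cor15_maxCut_holds` (KMR Cor. 1.5 MAX-CUT, discharged in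
`KMRLpLowerBoundsUnconditional.lean`; val-lit-lit g17 VET: no new Literature fact), through the size dictionary slack-form lift ↦
CLRS nonnegative-factorisation LP (`NnrLp.relaxation`, size `≤ 3R + 2n² + 4`); hence `maxCutLPApproxHard_holds`, `maxCutLPHard_holds`
and the classes K (`cutDominant_decided_holds`) and K_θ (`gapThin_decided_holds`, every `θ < 1`) are decided WITHOUT hypothesis, and
the line's KNOWN stub `stub_maxCutLPApproxHard` (`Lines/virtual_passenger.lean`) closes by `MaxCutLP.maxCutLPApproxHard_holds`.
§1–§5 = rev 2 verbatim (there `MaxCutLPHard` is called a named fact «no Literature port yet» — superseded by §6).  VP ≠ VNP NOT proved.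

THE LEVER.  Let `Q = conv{q_0,…,q_K} ⊂ ℝ^{h×h}` be a passenger such that ONE point `q_{j₀}` maximises over `Q` every
single-edge CUT direction `δ_{ij}(y) = y_ii + y_jj − y_ij − y_ji` (`i ≠ j`; `δ_{ij}(bbᵀ) = [b_i ≠ b_j]`) — class
`CutDominant`.  Translate by `−q_{j₀}`: then `R := COR(K_h) + Q − q_{j₀} ⊇ COR(K_h)` and for every NONNEGATIVE edge
weighting `w`, `max_R Σ w_ij δ_ij = maxcut(w)`: `R` is an LP relaxation of MAX-CUT on `h` vertices that is EXACT on every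
nonnegative instance (`isMaxCutRelaxation_of_cutDominant`).  Chan–Lee–Raghavendra–Steurer (FOCS 2013 / JACM 2016) and
Kothari–Meka–Raghavendra (STOC 2017 / SICOMP 2022, Thm 1.2: LPs of size `< 2^{h^δ}` do not beat ratio `1/2 + ε` for MAX-CUT)
bound the size of any such relaxation from below by `2^{h^δ}`, which beats the route threshold `T c h = 2^{(log₂ h + c)^c}`
eventually: named fact `MaxCutLPHard` (print THEOREM, not a conjecture; no Literature port yet).  Hence
`cutDominant_decided : MaxCutLPHard → (CutDominant h q → HasEFOfSize (COR(K_h) + conv q) r → T c h < r)` — a NEW DECIDED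
CLASS `K ⊋ F` for the line `virtual_passenger` (F = common extremiser of ALL `2^h` clique rows; K needs only the `C(h,2)` PAIR
rows, whose own UDISJ block is worthless), decided by a certificate OUTSIDE the located-face / UDISJ-embedding family
(Sherali–Adams pseudo-expectations + junta/lifting).  Members of `K ∖ (A⁺ ∪ D ∪ E ∪ B ∪ F ∪ G ∪ H)`: `Z_full = Σ_b [0,1]·bbᵀ`
(`zFull_cutDominant`), every zonotope / 0-1 rank-one tower `Σ_b [α_b, β_b]·bbᵀ`, every zonotope with PSD (indeed
cut-nonnegative) generators, `q₀ − P'` for any `P' ∋ 0` inside the dual cut cone (e.g. `COR − COR`).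
APPROXIMATE VERSION (value level, the necessary condition N9 on a cheap pair): `GapThin θ` (`∃ j₀ ∀ w ≥ 0 ∀ j,
L_w(q_j) ≤ L_w(q_{j₀}) + θ·maxcut(w)`) is decided for every `θ < 1` under `MaxCutLPApproxHard` (KMR: no ratio `> 1/2`).
OPEN (harvested, exp rate): `rank₊ [maxcut(w) − cut_w(b)]_{b,w} = 2^{Ω(h)}`? (= min size of an exact nonneg MAX-CUT LP
= xc of the pair (CUT, CUT↓); KMR give `2^{h^δ}`).  VP ≠ VNP is NOT proved here; 21181 OPEN; COR-VIRTUAL OPEN.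
-/

namespace Summit.ValiantsHypothesis.ValiantsHypothesis.Cruxes.NNDivisionHard.MaxCutLP

open Matrix Finset Filter Topology
open scoped Pointwise
open Literature.Barriers.PneNP (HasEFOfSize)
open Literature.Combinatorics.Optimization (corPolytopeGraph corVec)
open Summit.ValiantsHypothesis.ValiantsHypothesis.Cruxes.NNLinearDegreeCofactorHard.XcDivision (T)

variable {h : ℕ}

/-! ## §1 Cut directions, Laplacian values, max-cut -/

/-- the single-edge CUT direction `δ_{ij}(y) = y_ii + y_jj − y_ij − y_ji`. -/
def cutDirG (i j : Fin h) : Fin h × Fin h → ℝ :=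
  fun p => (if p = (i, i) then 1 else 0) + (if p = (j, j) then 1 else 0)
    - (if p = (i, j) then 1 else 0) - (if p = (j, i) then 1 else 0)

theorem cutDirG_dotProduct (i j : Fin h) (y : Fin h × Fin h → ℝ) :
    cutDirG i j ⬝ᵥ y = y (i, i) + y (j, j) - y (i, j) - y (j, i) := by
  simp only [cutDirG, dotProduct, add_mul, sub_mul, ite_mul, one_mul, zero_mul, Finset.sum_add_distrib,
    Finset.sum_sub_distrib, Finset.sum_ite_eq', Finset.mem_univ, if_true]

/-- `δ_{ij}(bbᵀ) = [b_i ≠ b_j] ∈ {0,1}` — in particular NONNEGATIVE on every vertex of `COR(K_h)`. -/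
theorem cutDirG_dot_corVec (i j : Fin h) (hij : i ≠ j) (b : Fin h → Bool) :
    cutDirG i j ⬝ᵥ corVec (⊤ : SimpleGraph (Fin h)) b = if b i = b j then 0 else 1 := by
  rw [cutDirG_dotProduct,
    Literature.Combinatorics.Optimization.corVec_apply_diag,
    Literature.Combinatorics.Optimization.corVec_apply_diag,
    Literature.Combinatorics.Optimization.corVec_apply_adj _ _ ((SimpleGraph.top_adj i j).2 hij),
    Literature.Combinatorics.Optimization.corVec_apply_adj _ _ ((SimpleGraph.top_adj j i).2 (Ne.symm hij))]
  cases b i <;> cases b j <;> simp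

theorem cutDirG_dot_corVec_nonneg (i j : Fin h) (hij : i ≠ j) (b : Fin h → Bool) :
    0 ≤ cutDirG i j ⬝ᵥ corVec (⊤ : SimpleGraph (Fin h)) b := by
  rw [cutDirG_dot_corVec i j hij]; split_ifs <;> norm_num

/-- off-diagonal part of a weighting (diagonal "edges" carry no cut direction). -/
def wOff (w : Fin h × Fin h → ℝ) (i j : Fin h) : ℝ := if i = j then 0 else w (i, j)

theorem wOff_nonneg {w : Fin h × Fin h → ℝ} (hw : ∀ p, 0 ≤ w p) (i j : Fin h) : 0 ≤ wOff w i j := by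
  unfold wOff; split_ifs
  · exact le_rfl
  · exact hw _

/-- the value of the weighted-graph (Laplacian) functional `L_w = Σ_{i≠j} w_ij δ_ij` at `y`. -/
def lapVal (w : Fin h × Fin h → ℝ) (y : Fin h × Fin h → ℝ) : ℝ :=
  ∑ i, ∑ j, wOff w i j * (cutDirG i j ⬝ᵥ y)

theorem lapVal_add (w : Fin h × Fin h → ℝ) (y z : Fin h × Fin h → ℝ) :
    lapVal w (y + z) = lapVal w y + lapVal w z := by
  simp [lapVal, dotProduct_add, mul_add, Finset.sum_add_distrib]

theorem lapVal_smul (w : Fin h × Fin h → ℝ) (c : ℝ) (y : Fin h × Fin h → ℝ) :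
    lapVal w (c • y) = c * lapVal w y := by
  simp [lapVal, dotProduct_smul, Finset.mul_sum, mul_left_comm]

theorem lapVal_neg (w : Fin h × Fin h → ℝ) (y : Fin h × Fin h → ℝ) :
    lapVal w (-y) = - lapVal w y := by
  have := lapVal_smul w (-1) y
  simpa using this

/-- a linear functional bounded by `δ` on `S` is bounded by `δ` on `conv S`. -/
theorem lapVal_le_of_mem_convexHull (w : Fin h × Fin h → ℝ) (S : Set (Fin h × Fin h → ℝ)) (δ : ℝ)
    (hS : ∀ x ∈ S, lapVal w x ≤ δ) : ∀ x ∈ convexHull ℝ S, lapVal w x ≤ δ := by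
  have hconv : Convex ℝ {x : Fin h × Fin h → ℝ | lapVal w x ≤ δ} :=
    convex_halfSpace_le ⟨fun x y => lapVal_add w x y, fun c x => by rw [lapVal_smul, smul_eq_mul]⟩ δ
  exact fun x hx => (convexHull_min (fun x hx => (hS x hx : x ∈ {x | lapVal w x ≤ δ})) hconv) hx

/-- cut value of the weighting `w` at the cut `b`. -/
def cutVal (w : Fin h × Fin h → ℝ) (b : Fin h → Bool) : ℝ := lapVal w (corVec (⊤ : SimpleGraph (Fin h)) b)

/-- MAX-CUT value of the weighting `w` (a maximum over the finitely many cuts). -/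
noncomputable def maxCut (w : Fin h × Fin h → ℝ) : ℝ :=
  (Finset.univ : Finset (Fin h → Bool)).sup' ⟨fun _ => false, Finset.mem_univ _⟩ (cutVal w)

theorem cutVal_le_maxCut (w : Fin h × Fin h → ℝ) (b : Fin h → Bool) : cutVal w b ≤ maxCut w :=
  Finset.le_sup' (cutVal w) (Finset.mem_univ b)

/-- `L_w ≤ maxcut(w)` on the whole correlation polytope. -/
theorem lapVal_le_maxCut_of_mem_cor (w : Fin h × Fin h → ℝ) :
    ∀ x ∈ corPolytopeGraph (⊤ : SimpleGraph (Fin h)), lapVal w x ≤ maxCut w := by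
  refine lapVal_le_of_mem_convexHull w _ _ ?_
  rintro _ ⟨b, rfl⟩
  exact cutVal_le_maxCut w b

/-! ## §2 MAX-CUT LP relaxations and the named facts (CLRS 2013 / KMR 2017) -/

/-- `R ⊇ COR(K_h)` is a `(1+θ)`-approximate LP relaxation of MAX-CUT on `h` vertices: its LP value on every NONNEGATIVE
instance is at most `(1+θ)·maxcut`.  `θ = 0`: EXACT relaxation. -/
def IsMaxCutApprox (θ : ℝ) (R : Set (Fin h × Fin h → ℝ)) : Prop :=
  corPolytopeGraph (⊤ : SimpleGraph (Fin h)) ⊆ R ∧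
    ∀ w : Fin h × Fin h → ℝ, (∀ p, 0 ≤ w p) → ∀ y ∈ R, lapVal w y ≤ (1 + θ) * maxCut w

/-- **named fact `MaxCutLPHard` (EXACT max-cut LPs are super-quasi-polynomial)** — a consequence of
Kothari–Meka–Raghavendra, *Approximating rectangles by juntas and weakly-exponential lower bounds for LP relaxations of
CSPs*, STOC 2017 / SICOMP 51 (2022), Thm 1.2 (every LP relaxation of MAX-CUT_h of size `< 2^{h^δ}` has integrality gap
`≥ 2 − ε`; an exact relaxation has gap 1), with Chan–Lee–Raghavendra–Steurer JACM 2016 (LP size vs Sherali–Adams) and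
Charikar–Makarychev–Makarychev 2009 (SA gaps) inside; `2^{h^δ} > T c h` eventually.  PRINT THEOREM; no Literature
port in the tree yet (port want).  [cite: KothariMekaRaghavendra2017 Thm 1.2; ChanLeeRaghavendraSteurer2016 Thm 1.1] -/
def MaxCutLPHard : Prop :=
  ∀ c : ℕ, ∃ h₀ : ℕ, ∀ h ≥ h₀, ∀ (R : Set (Fin h × Fin h → ℝ)) (r : ℕ),
    IsMaxCutApprox 0 R → HasEFOfSize R r → T c h < r

/-- **named fact `MaxCutLPApproxHard`** — the same source at every ratio above `1/2`: for each `θ < 1`,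
`(1+θ)`-approximate MAX-CUT LP relaxations are super-quasi-polynomial.  [cite: KothariMekaRaghavendra2017 Thm 1.2] -/
def MaxCutLPApproxHard : Prop :=
  ∀ θ : ℝ, θ < 1 → ∀ c : ℕ, ∃ h₀ : ℕ, ∀ h ≥ h₀, ∀ (R : Set (Fin h × Fin h → ℝ)) (r : ℕ),
    IsMaxCutApprox θ R → HasEFOfSize R r → T c h < r

theorem maxCutLPHard_of_approx (hA : MaxCutLPApproxHard) : MaxCutLPHard :=
  hA 0 (by norm_num)

/-! ## §3 The passenger classes: CUT-DOMINANT (`K`) and GAP-THIN (`K_θ`) -/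

/-- **CLASS K — CUT-DOMINANT passenger families**: one generator maximises every single-edge cut direction over the
family (hence over its hull).  Contains class F (`CommonExtremiser`: all clique rows; the pair rows are among them). -/
def CutDominant (h : ℕ) {J : Type} (q : J → (Fin h × Fin h → ℝ)) : Prop :=
  ∃ j₀, ∀ i j : Fin h, i ≠ j → ∀ j' : J, cutDirG i j ⬝ᵥ q j' ≤ cutDirG i j ⬝ᵥ q j₀

/-- **CLASS K_θ — GAP-THIN passenger families** (value level): one generator is, for every nonnegative instance `w`,
within `θ·maxcut(w)` of the family's maximum of `L_w`.  `K_0 ⊇ K`. -/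
def GapThin (θ : ℝ) (h : ℕ) {J : Type} (q : J → (Fin h × Fin h → ℝ)) : Prop :=
  ∃ j₀, ∀ w : Fin h × Fin h → ℝ, (∀ p, 0 ≤ w p) → ∀ j' : J, lapVal w (q j') ≤ lapVal w (q j₀) + θ * maxCut w

theorem gapThin_zero_of_cutDominant {J : Type} {q : J → (Fin h × Fin h → ℝ)} (hK : CutDominant h q) :
    GapThin 0 h q := by
  obtain ⟨j₀, hj₀⟩ := hK
  refine ⟨j₀, fun w hw j' => ?_⟩
  rw [zero_mul, add_zero]
  unfold lapVal
  refine Finset.sum_le_sum fun i _ => Finset.sum_le_sum fun j _ => ?_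
  by_cases hij : i = j
  · simp [wOff, hij]
  · exact mul_le_mul_of_nonneg_left (hj₀ i j hij j') (wOff_nonneg hw i j)

/-- ★ the translation lemma: a gap-thin family, translated so that its near-maximiser sits at the origin, turns
`COR(K_h) + Q` into a `(1+θ)`-approximate MAX-CUT LP relaxation. -/
theorem isMaxCutApprox_translate {θ : ℝ} {K : ℕ} {q : Fin (K + 1) → (Fin h × Fin h → ℝ)} {j₀ : Fin (K + 1)}
    (hj₀ : ∀ w : Fin h × Fin h → ℝ, (∀ p, 0 ≤ w p) → ∀ j', lapVal w (q j') ≤ lapVal w (q j₀) + θ * maxCut w) :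
    IsMaxCutApprox θ ((fun x => x + -(q j₀)) ''
      (corPolytopeGraph (⊤ : SimpleGraph (Fin h)) + convexHull ℝ (Set.range q))) := by
  constructor
  · intro x hx
    refine ⟨x + q j₀, ?_, by simp⟩
    exact Set.add_mem_add hx (subset_convexHull ℝ _ ⟨j₀, rfl⟩)
  · rintro w hw _ ⟨y, hy, rfl⟩
    obtain ⟨p, hp, z, hz, rfl⟩ := Set.mem_add.1 hy
    have hpz : lapVal w (p + z + -(q j₀)) = lapVal w p + (lapVal w z - lapVal w (q j₀)) := by
      rw [lapVal_add, lapVal_add, lapVal_neg]; ring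
    have h1 : lapVal w p ≤ maxCut w := lapVal_le_maxCut_of_mem_cor w p hp
    have h2 : lapVal w z ≤ lapVal w (q j₀) + θ * maxCut w := by
      refine lapVal_le_of_mem_convexHull w (Set.range q) _ ?_ z hz
      rintro _ ⟨j', rfl⟩
      exact hj₀ w hw j'
    rw [hpz]
    linarith

/-- ★★ **CLASS K_θ IS DECIDED modulo KMR**: gap-thin budgeted-or-not passengers do not make `COR(K_h) + Q`
quasi-polynomially cheap. -/
theorem gapThin_decided (hM : MaxCutLPApproxHard) (θ : ℝ) (hθ : θ < 1) :
    ∀ c : ℕ, ∃ h₀ : ℕ, ∀ h ≥ h₀, ∀ (K : ℕ) (q : Fin (K + 1) → (Fin h × Fin h → ℝ)) (r : ℕ),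
      GapThin θ h q →
      HasEFOfSize (corPolytopeGraph (⊤ : SimpleGraph (Fin h)) + convexHull ℝ (Set.range q)) r → T c h < r := by
  intro c
  obtain ⟨h₀, hh₀⟩ := hM θ hθ c
  refine ⟨h₀, fun h hh K q r hK hEF => ?_⟩
  obtain ⟨j₀, hj₀⟩ := hK
  exact hh₀ h hh _ r (isMaxCutApprox_translate hj₀) (hEF.image_add_const (-(q j₀)))

/-- ★★ **CLASS K IS DECIDED modulo KMR (exact form)**: cut-dominant passengers — `Z_full`, every 0-1 rank-one tower,
every zonotope with cut-nonnegative generators — do not make `COR(K_h) + Q` quasi-polynomially cheap. -/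
theorem cutDominant_decided (hM : MaxCutLPHard) :
    ∀ c : ℕ, ∃ h₀ : ℕ, ∀ h ≥ h₀, ∀ (K : ℕ) (q : Fin (K + 1) → (Fin h × Fin h → ℝ)) (r : ℕ),
      CutDominant h q →
      HasEFOfSize (corPolytopeGraph (⊤ : SimpleGraph (Fin h)) + convexHull ℝ (Set.range q)) r → T c h < r := by
  intro c
  obtain ⟨h₀, hh₀⟩ := hM c
  refine ⟨h₀, fun h hh K q r hK hEF => ?_⟩
  obtain ⟨j₀, hj₀⟩ := gapThin_zero_of_cutDominant hK
  exact hh₀ h hh _ r (isMaxCutApprox_translate hj₀) (hEF.image_add_const (-(q j₀)))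

/-! ## §4 Sanity members: `Z_full` and the rank-one towers are cut-dominant -/

/-- the spanning points of the zonotope `Z_full = Σ_{b} [0,1]·bbᵀ`: the sub-sums `Σ_{b ∈ S} bbᵀ`
(`conv` of these IS the zonotope). -/
noncomputable def zGen (S : Finset (Fin h → Bool)) : Fin h × Fin h → ℝ :=
  fun p => ∑ b ∈ S, corVec (⊤ : SimpleGraph (Fin h)) b p

theorem cutDirG_dot_zGen (i j : Fin h) (S : Finset (Fin h → Bool)) :
    cutDirG i j ⬝ᵥ zGen S = ∑ b ∈ S, cutDirG i j ⬝ᵥ corVec (⊤ : SimpleGraph (Fin h)) b := by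
  simp only [dotProduct, zGen, Finset.mul_sum]
  rw [Finset.sum_comm]

/-- ★ `Z_full` (presented by its `2^{2^h}` spanning points) is CUT-DOMINANT: the top point `Σ_b bbᵀ` maximises every
edge direction, because every generator `bbᵀ` has `δ_{ij}(bbᵀ) = [b_i ≠ b_j] ≥ 0`.  The same proof covers every
sub-family of generators (all truncations `Z_S`) — the index `S` ranges over them. -/
theorem zFull_cutDominant (h : ℕ) : CutDominant h (zGen (h := h)) := by
  refine ⟨Finset.univ, fun i j hij S => ?_⟩
  rw [cutDirG_dot_zGen, cutDirG_dot_zGen]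
  exact Finset.sum_le_sum_of_subset_of_nonneg (Finset.subset_univ S)
    (fun b _ _ => cutDirG_dot_corVec_nonneg i j hij b)

/-- general rank-one towers `Σ_b [α_b, β_b]·bbᵀ` (`α ≤ β`): spanning points `Σ_b t_b·bbᵀ` with `t_b ∈ {α_b, β_b}`,
indexed by the choice function; the top choice `t = β` is a common maximiser of all edge directions. -/
noncomputable def towerGen (α β : (Fin h → Bool) → ℝ) (t : (Fin h → Bool) → Bool) : Fin h × Fin h → ℝ :=
  fun p => ∑ b, (if t b then β b else α b) * corVec (⊤ : SimpleGraph (Fin h)) b p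

theorem cutDirG_dot_towerGen (i j : Fin h) (α β : (Fin h → Bool) → ℝ) (t : (Fin h → Bool) → Bool) :
    cutDirG i j ⬝ᵥ towerGen α β t =
      ∑ b, (if t b then β b else α b) * (cutDirG i j ⬝ᵥ corVec (⊤ : SimpleGraph (Fin h)) b) := by
  simp only [dotProduct, towerGen, Finset.mul_sum]
  rw [Finset.sum_comm]
  refine Finset.sum_congr rfl fun b _ => Finset.sum_congr rfl fun p _ => ?_
  ring

theorem tower_cutDominant (h : ℕ) (α β : (Fin h → Bool) → ℝ) (hαβ : ∀ b, α b ≤ β b) :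
    CutDominant h (towerGen α β) := by
  refine ⟨fun _ => true, fun i j hij t => ?_⟩
  rw [cutDirG_dot_towerGen, cutDirG_dot_towerGen]
  refine Finset.sum_le_sum fun b _ => ?_
  have hnn := cutDirG_dot_corVec_nonneg i j hij b
  refine mul_le_mul_of_nonneg_right ?_ hnn
  simp only [if_true]
  split_ifs
  · exact le_rfl
  · exact hαβ b


/-! ## §5 P1 (crit-9 VERDICT #9): the PORT-READY Literature block `KMR` and the bridge `KMR.MaxCutLPGapHard → MaxCutLPHard`

The sub-namespace `KMR` below is written to be moved VERBATIM into
`Literature/Barriers/PneNP/MaxCutLPRelaxationsKMR.lean` (namespace `Literature.Barriers.PneNP.MaxCutLPRelaxationsKMR`):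
statement-only, no instances / notation, the Chan–Lee–Raghavendra–Steurer LP-relaxation model spelled out (linearisation,
linear objective per instance, one feasible region, size = inequalities of a slack-form lift), and ONE named fact
`MaxCutLPGapHard` = Kothari–Meka–Raghavendra SICOMP 51 (2022) Thm 1.2 + Charikar–Makarychev–Makarychev 2009 ⇒ Cor. 1.5 of
arXiv:1610.02704v4.  The bridge theorems `maxCutLPHard_of_kmr`, `maxCutLPApproxHard_of_kmr` then make the sketch's named
consequences `MaxCutLPHard` / `MaxCutLPApproxHard` THEOREMS modulo the Literature fact, with the one analytic input
`polylog_lt_rpow_eventually` (`(log₂ h + c₀)^{c₀} < h^c` eventually). -/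

namespace KMR

/-- value of the cut `b : Fin n → Bool` under a weighting `w` of ORDERED pairs: `Σ_{i,j} w i j · [b i ≠ b j]`
(MAX-CUT = the Max-CSP of the binary disequality predicate; a symmetric instance is counted twice, immaterial for
ratios; diagonal pairs contribute nothing). [cite: ChanLeeRaghavendraSteurer2016, §2 (PDF p. 8) "Max Cut corresponds to
the case where Π consists of the binary inequality predicate"] -/
def cutValue {n : ℕ} (w : Fin n → Fin n → ℝ) (b : Fin n → Bool) : ℝ :=
  ∑ i, ∑ j, if b i = b j then 0 else w i j

/-- the optimum `opt(w) = max_b cutValue w b`. -/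
noncomputable def maxCutValue {n : ℕ} (w : Fin n → Fin n → ℝ) : ℝ :=
  (Finset.univ : Finset (Fin n → Bool)).sup' ⟨fun _ => false, Finset.mem_univ _⟩ (cutValue w)

/-- **LP relaxation of MAX-CUT on `n` vertices** in the sense of Chan–Lee–Raghavendra–Steurer: a LINEARISATION in a
finite coordinate type `D` — one point `pt b ∈ ℝ^D` per cut `b`, one linear objective `obj w ∈ ℝ^D` per (nonnegative)
instance `w` with `⟨obj w, pt b⟩ = cutValue w b`, and ONE feasible region `feasible ⊆ ℝ^D`, independent of the instance,
containing every `pt b`; its LP value on `w` is `sup_{y ∈ feasible} ⟨obj w, y⟩ ≥ opt(w)`.  Extended formulations and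
Sherali–Adams / Lovász–Schrijver LPs are captured (`D` is arbitrary). [cite: ChanLeeRaghavendraSteurer2016, §2 (PDF p. 8)
"An LP-relaxation of size R for Max-Πₙ consists of … Linearization … Feasible region: a closed convex (possibly unbounded)
polyhedron P ⊆ ℝ^D described by R linear inequalities, such that x̃ ∈ P for all assignments … independent of the
instance"; KothariMekaRaghavendra2022, §1 "generalizes the extended formulation framework of Yannakakis"] -/
structure LPRelaxation (n : ℕ) (D : Type) [Fintype D] where
  /-- the linearised cuts `ỹ_b` -/
  pt : (Fin n → Bool) → D → ℝ
  /-- the linearised instances `w̃` -/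
  obj : (Fin n → Fin n → ℝ) → D → ℝ
  /-- the feasible region `P` -/
  feasible : Set (D → ℝ)
  /-- `⟨w̃, ỹ_b⟩ = w(b)` for every nonnegative instance and every cut -/
  consistent : ∀ w : Fin n → Fin n → ℝ, (∀ i j, 0 ≤ w i j) → ∀ b, obj w ⬝ᵥ pt b = cutValue w b
  /-- `ỹ_b ∈ P` -/
  contains : ∀ b, pt b ∈ feasible

/-- the relaxation has INTEGRALITY GAP AT MOST `α`: its LP value is `≤ α · opt(w)` on every nonnegative instance
(`α = 1`: exact). [cite: ChanLeeRaghavendraSteurer2016, §2 (PDF p. 9) "L achieves an α-factor approximation if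
L(ℑ) ≤ α·opt(ℑ) for all ℑ"] -/
def LPRelaxation.GapLE {n : ℕ} {D : Type} [Fintype D] (L : LPRelaxation n D) (α : ℝ) : Prop :=
  ∀ w : Fin n → Fin n → ℝ, (∀ i j, 0 ≤ w i j) → ∀ y ∈ L.feasible, L.obj w ⬝ᵥ y ≤ α * maxCutValue w

/-- the relaxation has SIZE AT MOST `R`: the feasible region is the projection of a slack-form system with `R`
inequalities (`HasEFOfSize`; CLRS count the inequalities describing `P ⊆ ℝ^D` with `D` arbitrary — the same measure,
equalities contributing no slack rows). [cite: ChanLeeRaghavendraSteurer2016, §2 (PDF p. 8) and §2 (PDF p. 13) "no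
specific meaning is ascribed to the variables of the LP. All that matters is the number of defining inequalities"] -/
def LPRelaxation.SizeLE {n : ℕ} {D : Type} [Fintype D] (L : LPRelaxation n D) (R : ℕ) : Prop :=
  HasEFOfSize L.feasible R

/-- **named fact `MaxCutLPGapHard` (Kothari–Meka–Raghavendra: weakly-exponential LPs do not beat gap 2 for MAX-CUT).**
For every `ε > 0` there are `c > 0` and `n₀` such that for `n ≥ n₀` every LP relaxation of MAX-CUT on `n` vertices with
integrality gap at most `2 − ε` has size at least `2^{n^c}`.  PRINT THEOREM (Thm 1.2: LPs of size `n^{h·f(n)}` are no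
stronger than `f(n)`-round Sherali–Adams; with the `n^{γ(ε)}`-round Sherali–Adams gap `2 − ε` of Charikar–Makarychev–
Makarychev); stated here with "gap ≤ 2 − ε" (apply print with `ε/2`) and over all real nonnegative instances (print:
normalised multigraph instances — a weaker requirement on the relaxation, so this statement is implied).
[cite: KothariMekaRaghavendra2022, Thm 1.2 and Cor. 1.5 (arXiv:1610.02704v4 §1: "no LP relaxation of size less than
2^{n^{c₃(ε)}} has integrality gap less than (2−ε) for Max-CUT"); CharikarMakarychevMakarychev2009, Thm 1.1] -/
def MaxCutLPGapHard : Prop :=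
  ∀ ε : ℝ, 0 < ε → ∃ c : ℝ, 0 < c ∧ ∃ n₀ : ℕ, ∀ n ≥ n₀, ∀ (D : Type) [Fintype D] (L : LPRelaxation n D) (R : ℕ),
    L.GapLE (2 - ε) → L.SizeLE R → (2 : ℝ) ^ ((n : ℝ) ^ c) ≤ R

theorem cutValue_const {n : ℕ} (w : Fin n → Fin n → ℝ) (c : Bool) : cutValue w (fun _ => c) = 0 := by
  simp [cutValue]

theorem maxCutValue_nonneg {n : ℕ} (w : Fin n → Fin n → ℝ) : 0 ≤ maxCutValue w := by
  rw [← cutValue_const w false]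
  exact Finset.le_sup' (cutValue w) (Finset.mem_univ _)

theorem LPRelaxation.GapLE.mono {n : ℕ} {D : Type} [Fintype D] {L : LPRelaxation n D} {α β : ℝ} (h : L.GapLE α)
    (hαβ : α ≤ β) : L.GapLE β :=
  fun w hw y hy => (h w hw y hy).trans (mul_le_mul_of_nonneg_right hαβ (maxCutValue_nonneg w))

end KMR

/-! ### the bridge -/

/-- the one analytic input: a fixed power of `log₂ h` is eventually below any positive power of `h`. -/
theorem polylog_lt_rpow_eventually (c₀ : ℕ) {c : ℝ} (hc : 0 < c) :
    ∃ h₀ : ℕ, ∀ h ≥ h₀, (((Nat.log 2 h + c₀) ^ c₀ : ℕ) : ℝ) < (h : ℝ) ^ c := by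
  set r : ℝ := (2 : ℝ) ^ c with hr_def
  have hr : 1 < r := Real.one_lt_rpow one_lt_two hc
  have hr0 : 0 < r := lt_trans zero_lt_one hr
  have h1 : Tendsto (fun k : ℕ => (((k + c₀ : ℕ) : ℝ)) ^ c₀ / r ^ (k + c₀)) atTop (𝓝 0) :=
    (tendsto_pow_const_div_const_pow_of_one_lt c₀ hr).comp (tendsto_add_atTop_nat c₀)
  have hε : (0 : ℝ) < 1 / r ^ c₀ := by positivity
  obtain ⟨K, hK⟩ := Filter.eventually_atTop.mp (h1.eventually (gt_mem_nhds hε))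
  refine ⟨2 ^ K, fun h hh => ?_⟩
  set k := Nat.log 2 h with hk
  have hh0 : h ≠ 0 := by
    have : 0 < 2 ^ K := Nat.two_pow_pos K
    omega
  have hlow : 2 ^ k ≤ h := Nat.pow_log_le_self 2 hh0
  have hup : h < 2 ^ (k + 1) := Nat.lt_pow_succ_log_self (by norm_num) h
  have hKk : K ≤ k := by
    by_contra hlt
    push_neg at hlt
    have : 2 ^ (k + 1) ≤ 2 ^ K := Nat.pow_le_pow_right (by norm_num) hlt
    omega
  have hA : (((k + c₀ : ℕ) : ℝ)) ^ c₀ / r ^ (k + c₀) < 1 / r ^ c₀ := hK k hKk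
  have hpos : (0 : ℝ) < r ^ (k + c₀) := by positivity
  have hA' : (((k + c₀ : ℕ) : ℝ)) ^ c₀ < 1 / r ^ c₀ * r ^ (k + c₀) := (div_lt_iff₀ hpos).mp hA
  have hsplit : 1 / r ^ c₀ * r ^ (k + c₀) = r ^ k := by
    rw [pow_add]; field_simp
  rw [hsplit] at hA'
  -- `r ^ k = (2 ^ k) ^ c ≤ h ^ c`
  have hrk : r ^ k = ((2 : ℝ) ^ k) ^ c := by
    rw [hr_def, ← Real.rpow_mul_natCast (by norm_num : (0 : ℝ) ≤ 2), mul_comm,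
      Real.rpow_natCast_mul (by norm_num : (0 : ℝ) ≤ 2)]
  have hle : ((2 : ℝ) ^ k) ^ c ≤ (h : ℝ) ^ c :=
    Real.rpow_le_rpow (by positivity) (by exact_mod_cast hlow) hc.le
  have hcast : (((Nat.log 2 h + c₀) ^ c₀ : ℕ) : ℝ) = (((k + c₀ : ℕ) : ℝ)) ^ c₀ := by
    rw [hk]; push_cast; ring
  rw [hcast]
  calc (((k + c₀ : ℕ) : ℝ)) ^ c₀ < r ^ k := hA'
    _ = ((2 : ℝ) ^ k) ^ c := hrk
    _ ≤ (h : ℝ) ^ c := hle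

/-- the Laplacian functional `L_w` as a VECTOR (for the CLRS linearisation). -/
def lapVec (w : Fin h × Fin h → ℝ) : Fin h × Fin h → ℝ :=
  fun p => ∑ i, ∑ j, wOff w i j * cutDirG i j p

theorem lapVec_dotProduct (w y : Fin h × Fin h → ℝ) : lapVec w ⬝ᵥ y = lapVal w y := by
  simp only [lapVec, dotProduct, lapVal, Finset.sum_mul, mul_assoc]
  rw [Finset.sum_comm]
  refine Finset.sum_congr rfl fun i _ => ?_
  rw [Finset.sum_comm]
  refine Finset.sum_congr rfl fun j _ => ?_
  rw [Finset.mul_sum]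

theorem cutValue_eq_cutVal (w : Fin h × Fin h → ℝ) (b : Fin h → Bool) :
    KMR.cutValue (fun i j => w (i, j)) b = cutVal w b := by
  unfold KMR.cutValue cutVal lapVal
  refine Finset.sum_congr rfl fun i _ => Finset.sum_congr rfl fun j _ => ?_
  by_cases hij : i = j
  · subst hij; simp [wOff]
  · rw [cutDirG_dot_corVec i j hij, wOff, if_neg hij]
    split_ifs <;> simp

theorem maxCutValue_eq_maxCut (w : Fin h × Fin h → ℝ) : KMR.maxCutValue (fun i j => w (i, j)) = maxCut w := by
  unfold KMR.maxCutValue maxCut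
  exact Finset.sup'_congr _ rfl fun b _ => cutValue_eq_cutVal w b

/-- ★ an `IsMaxCutApprox θ` region IS a CLRS relaxation (linearisation `bbᵀ`, objective `lapVec w`) of gap `≤ 1 + θ`. -/
noncomputable def toKMR {θ : ℝ} {R : Set (Fin h × Fin h → ℝ)} (hR : IsMaxCutApprox θ R) :
    KMR.LPRelaxation h (Fin h × Fin h) where
  pt := fun b => corVec (⊤ : SimpleGraph (Fin h)) b
  obj := fun w => lapVec (fun p => w p.1 p.2)
  feasible := R
  consistent := by
    intro w _ b
    rw [lapVec_dotProduct]
    exact (cutValue_eq_cutVal (fun p => w p.1 p.2) b).symm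
  contains := fun b => hR.1 (subset_convexHull ℝ _ ⟨b, rfl⟩)

theorem toKMR_gapLE {θ : ℝ} {R : Set (Fin h × Fin h → ℝ)} (hR : IsMaxCutApprox θ R) :
    (toKMR hR).GapLE (1 + θ) := by
  intro w hw y hy
  have h1 := hR.2 (fun p => w p.1 p.2) (fun p => hw p.1 p.2) y hy
  have h2 : KMR.maxCutValue w = maxCut (fun p : Fin h × Fin h => w p.1 p.2) := by
    have := maxCutValue_eq_maxCut (h := h) (fun p => w p.1 p.2)
    simpa using this
  change lapVec (fun p => w p.1 p.2) ⬝ᵥ y ≤ (1 + θ) * KMR.maxCutValue w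
  rw [lapVec_dotProduct, h2]
  exact h1

theorem toKMR_sizeLE {θ : ℝ} {R : Set (Fin h × Fin h → ℝ)} (hR : IsMaxCutApprox θ R) {r : ℕ}
    (hEF : HasEFOfSize R r) : (toKMR hR).SizeLE r := hEF

/-- `T c h < r` from `2^{h^{c₃}} ≤ r`, eventually. -/
theorem T_lt_of_kmr_bound (c : ℕ) {c₃ : ℝ} (hc₃ : 0 < c₃) :
    ∃ h₀ : ℕ, ∀ h ≥ h₀, ∀ r : ℕ, (2 : ℝ) ^ ((h : ℝ) ^ c₃) ≤ r → T c h < r := by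
  obtain ⟨h₀, hh₀⟩ := polylog_lt_rpow_eventually c hc₃
  refine ⟨h₀, fun h hh r hr => ?_⟩
  have hlt : (((Nat.log 2 h + c) ^ c : ℕ) : ℝ) < (h : ℝ) ^ c₃ := hh₀ h hh
  have hT : ((T c h : ℕ) : ℝ) = (2 : ℝ) ^ ((((Nat.log 2 h + c) ^ c : ℕ) : ℝ)) := by
    rw [Real.rpow_natCast]; push_cast; rfl
  have h2 : (2 : ℝ) ^ ((((Nat.log 2 h + c) ^ c : ℕ) : ℝ)) < (2 : ℝ) ^ ((h : ℝ) ^ c₃) :=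
    Real.rpow_lt_rpow_of_exponent_lt (by norm_num) hlt
  have : ((T c h : ℕ) : ℝ) < r := by rw [hT]; exact lt_of_lt_of_le h2 hr
  exact_mod_cast this

/-- ★★ **the bridge (exact form)**: the Literature fact implies the sketch's named consequence. -/
theorem maxCutLPApproxHard_of_kmr (hK : KMR.MaxCutLPGapHard) : MaxCutLPApproxHard := by
  intro θ hθ c
  obtain ⟨c₃, hc₃, n₀, hn₀⟩ := hK (1 - θ) (by linarith)
  obtain ⟨h₁, hh₁⟩ := T_lt_of_kmr_bound c hc₃
  refine ⟨max n₀ h₁, fun h hh R r hR hEF => ?_⟩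
  have hn : n₀ ≤ h := le_trans (le_max_left _ _) hh
  have hh1 : h₁ ≤ h := le_trans (le_max_right _ _) hh
  have hgap : (toKMR hR).GapLE (2 - (1 - θ)) := (toKMR_gapLE hR).mono (by linarith)
  exact hh₁ h hh1 r (hn₀ h hn _ (toKMR hR) r hgap (toKMR_sizeLE hR hEF))

/-- ★★ **the bridge**: `KMR.MaxCutLPGapHard → MaxCutLPHard`; hence `cutDominant_decided (maxCutLPHard_of_kmr hK)`. -/
theorem maxCutLPHard_of_kmr (hK : KMR.MaxCutLPGapHard) : MaxCutLPHard :=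
  maxCutLPHard_of_approx (maxCutLPApproxHard_of_kmr hK)

/-- the decided-class theorem restated against the Literature fact. -/
theorem cutDominant_decided_kmr (hK : KMR.MaxCutLPGapHard) :
    ∀ c : ℕ, ∃ h₀ : ℕ, ∀ h ≥ h₀, ∀ (K : ℕ) (q : Fin (K + 1) → (Fin h × Fin h → ℝ)) (r : ℕ),
      CutDominant h q →
      HasEFOfSize (corPolytopeGraph (⊤ : SimpleGraph (Fin h)) + convexHull ℝ (Set.range q)) r → T c h < r :=
  cutDominant_decided (maxCutLPHard_of_kmr hK)

theorem gapThin_decided_kmr (hK : KMR.MaxCutLPGapHard) (θ : ℝ) (hθ : θ < 1) :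
    ∀ c : ℕ, ∃ h₀ : ℕ, ∀ h ≥ h₀, ∀ (K : ℕ) (q : Fin (K + 1) → (Fin h × Fin h → ℝ)) (r : ℕ),
      GapThin θ h q →
      HasEFOfSize (corPolytopeGraph (⊤ : SimpleGraph (Fin h)) + convexHull ℝ (Set.range q)) r → T c h < r :=
  gapThin_decided (maxCutLPApproxHard_of_kmr hK) θ hθ


/-! ## §6 (REV 3, val-idea-43 g3) P1 PAID UNCONDITIONALLY: `KMR.MaxCutLPGapHard` IS A THEOREM OF THE TREE

val-lit-lit g17 VET (2026-08-28T20:09Z): Kothari–Meka–Raghavendra Cor. 1.5 for MAX-CUT is already TYPED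
(`Literature.Combinatorics.Optimization.KothariMekaRaghavendra2017_cor15_maxCut`, over the KMR/CLRS model
`LPRelaxation 2 n maxCutPreds R` of `LPRelaxationsMaxCSP.lean`) and DISCHARGED
(`KothariMekaRaghavendra2017_cor15_maxCut_holds`, `KMRLpLowerBoundsUnconditional.lean`: KMR Thm 1.10 + the
Charikar–Makarychev–Makarychev Sherali–Adams gap are tree theorems).  So no Literature fact is filed; this section is
the Summits-side BRIDGE between the two measures of "size":

* §5's `KMR.LPRelaxation n D` measures size by `HasEFOfSize feasible R` = `R` slack rows of a slack-form lift
  `{x | ∃ y ≥ 0, E x + F y = g}` (equalities free, feasible region possibly unbounded, `D` arbitrary);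
* the tree's `LPRelaxation 2 n maxCutPreds R'` measures size by `R'` inequalities of a BOUNDED description.

DICTIONARY.  A tree instance `I : CSPInstance 2 n maxCutPreds` (M constraints "x_i ≠ x_j" on ordered pairs of
distinct variables, value = fraction satisfied) is the weighting `instWeight I i j = #{c : idx c = (i,j)} / M ≥ 0`, with
`cutValue (instWeight I) b = I.val b` and `maxCutValue (instWeight I) = I.opt`.
BRIDGE (Chan–Lee–Raghavendra–Steurer Thm 2.3 ⇐, as typed in the tree's `NnrLp`).  Given `L` with gap `≤ 2 − ε` and a
size-`R` lift `Q` of `L.feasible`, choose for every cut `b` a slack vector `y_b ≥ 0` (`E·pt b + F·y_b = g`) and put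
`V l b := (y_b)_l ≥ 0`.  For an instance `I`, LP duality on the lift (`liftCertificate` = g0's
`VirtualXc.affineRowCertificateComplete_holds` inlined = tree `LPDuality.affine_farkas`) turns the valid inequality `⟨obj w_I, ·⟩ ≤ (2−ε)·opt` into multipliers `μ` with
`obj w_I = −μE`, `U := −μF ≥ 0`, `c' := −μ·g ≤ (2−ε)·opt`, whence `c' − I.val b = Σ_l U_l · V l b` for every cut:
a NONNEGATIVE FACTORISATION through the `R` slack coordinates.  The tree's `NnrLp.relaxation V` (size
`≤ 3R + 2n² + 4`, bounded by construction) then achieves ratio `2 − ε` on every instance (`Feasible.val_le`), so has gap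
`< 2 − ε/2`, and `KothariMekaRaghavendra2017_cor15_maxCut_holds (ε/2)` forces `2^{n^{c₃}} ≤ 3R + 2n² + 4`, i.e.
`2^{n^{c₃/2}} ≤ R` eventually.  CONSEQUENCES (hypothesis-free): `maxCutLPApproxHard_holds`, `maxCutLPHard_holds`,
`cutDominant_decided_holds` (class K), `gapThin_decided_holds` (class K_θ, every θ < 1); the line's KNOWN stub
`stub_maxCutLPApproxHard : MaxCutLP43.MaxCutLPApproxHard` (a byte-identical copy of `MaxCutLPApproxHard`) closes by
`exact MaxCutLP.maxCutLPApproxHard_holds`.  VP ≠ VNP is NOT proved here; 21181 OPEN; COR-VIRTUAL OPEN. -/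

section Unconditional

open Literature.Combinatorics.Optimization (CSPInstance CSPConstraint maxCutPreds
  KothariMekaRaghavendra2017_cor15_maxCut_holds)
open Literature.Barriers.PneNP (ExtendedFormulation)


/-! ### §6⁰ LP duality on a slack-form lift (g0's `VirtualXc.affineRowCertificateComplete_holds`, INLINED so that this
module imports no crux workfile and §6 can be pasted verbatim into the line file) -/

/-- a valid inequality `0 ≤ c + ⟨yrow, u⟩` on the NONEMPTY projection `QQ.projSet = {u | ∃ v ≥ 0, E u + F v = g}` of a
slack-form system has Farkas multipliers `μ` with `yrow = μE`, `μF ≤ 0`, `0 ≤ μ·g + c`.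
[folklore LP duality: tree `LPDuality.affine_farkas` = Schrijver, Theory of LP and IP, Cor. 7.1h] -/
theorem liftCertificate {ι : Type} [Fintype ι] {s : ℕ} (QQ : ExtendedFormulation ι s) (yrow : ι → ℝ) (c : ℝ)
    (hne : QQ.projSet.Nonempty) (hval : ∀ u ∈ QQ.projSet, 0 ≤ c + yrow ⬝ᵥ u) :
    ∃ μ : Fin QQ.k → ℝ, yrow = μ ᵥ* QQ.E ∧ (∀ i, (μ ᵥ* QQ.F) i ≤ 0) ∧ 0 ≤ μ ⬝ᵥ QQ.g + c := by
  classical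
  -- rows: (E-rows ≤) ⊕ (E-rows ≥, written as −… ≤ −g) ⊕ (−v ≤ 0); columns: u-coordinates ⊕ v-coordinates
  let A : Matrix ((Fin QQ.k ⊕ Fin QQ.k) ⊕ Fin s) (ι ⊕ Fin s) ℝ := Matrix.of fun i j =>
    match i with
    | Sum.inl (Sum.inl i') => Sum.elim (fun j' => QQ.E i' j') (fun j' => QQ.F i' j') j
    | Sum.inl (Sum.inr i') => - Sum.elim (fun j' => QQ.E i' j') (fun j' => QQ.F i' j') j
    | Sum.inr i' => Sum.elim (fun _ => (0 : ℝ)) (fun j' => if j' = i' then (-1 : ℝ) else 0) j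
  let b : ((Fin QQ.k ⊕ Fin QQ.k) ⊕ Fin s) → ℝ := Sum.elim (Sum.elim QQ.g (-QQ.g)) (fun _ => 0)
  let cc : ι ⊕ Fin s → ℝ := Sum.elim (-yrow) (fun _ => 0)
  -- evaluation of the three row blocks
  have hrow1 : ∀ z : ι ⊕ Fin s → ℝ, ∀ i' : Fin QQ.k,
      (A *ᵥ z) (Sum.inl (Sum.inl i')) = (QQ.E *ᵥ (fun j => z (Sum.inl j)) + QQ.F *ᵥ (fun j => z (Sum.inr j))) i' := by
    intro z i'
    simp [A, Matrix.mulVec, dotProduct, Fintype.sum_sum_type, Matrix.of_apply]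
  have hrow2 : ∀ z : ι ⊕ Fin s → ℝ, ∀ i' : Fin QQ.k,
      (A *ᵥ z) (Sum.inl (Sum.inr i')) = - (QQ.E *ᵥ (fun j => z (Sum.inl j)) + QQ.F *ᵥ (fun j => z (Sum.inr j))) i' := by
    intro z i'
    simp [A, Matrix.mulVec, dotProduct, Fintype.sum_sum_type, Matrix.of_apply, Finset.sum_neg_distrib, neg_add]
  have hrow3 : ∀ z : ι ⊕ Fin s → ℝ, ∀ i' : Fin s, (A *ᵥ z) (Sum.inr i') = - z (Sum.inr i') := by
    intro z i'
    simp [A, Matrix.mulVec, dotProduct, Fintype.sum_sum_type, Matrix.of_apply]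
  -- A z ≤ b ↔ lifted feasibility
  have hAz : ∀ z : ι ⊕ Fin s → ℝ, A *ᵥ z ≤ b ↔
      (QQ.E *ᵥ (fun j => z (Sum.inl j)) + QQ.F *ᵥ (fun j => z (Sum.inr j)) = QQ.g ∧ ∀ j, 0 ≤ z (Sum.inr j)) := by
    intro z
    constructor
    · intro h
      refine ⟨?_, ?_⟩
      · funext i'
        have h1 := h (Sum.inl (Sum.inl i'))
        have h2 := h (Sum.inl (Sum.inr i'))
        rw [hrow1] at h1
        rw [hrow2] at h2
        simp [b] at h1 h2
        rw [Pi.add_apply]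
        linarith
      · intro j
        have h3 := h (Sum.inr j)
        rw [hrow3] at h3
        simp [b] at h3
        linarith
    · rintro ⟨heq, hv⟩ i
      rcases i with (i' | i') | i'
      · rw [hrow1, heq]; simp [b]
      · rw [hrow2, heq]; simp [b]
      · rw [hrow3]; simp [b]; linarith [hv i']
  -- feasibility and validity of `cc ⬝ᵥ z ≤ c`
  have hP : ∃ z : ι ⊕ Fin s → ℝ, A *ᵥ z ≤ b := by
    obtain ⟨u, v, hv, huv⟩ := hne
    refine ⟨Sum.elim u v, (hAz _).mpr ⟨?_, fun j => by simpa using hv j⟩⟩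
    simpa using huv
  have hcc : ∀ z : ι ⊕ Fin s → ℝ, cc ⬝ᵥ z = - (yrow ⬝ᵥ fun j => z (Sum.inl j)) := by
    intro z
    simp [cc, dotProduct, Fintype.sum_sum_type, Finset.sum_neg_distrib]
  have hδ : ∀ z : ι ⊕ Fin s → ℝ, A *ᵥ z ≤ b → cc ⬝ᵥ z ≤ c := by
    intro z hz
    obtain ⟨heq, hv⟩ := (hAz z).mp hz
    have hu : (fun j => z (Sum.inl j)) ∈ QQ.projSet := ⟨fun j => z (Sum.inr j), hv, heq⟩
    have := hval _ hu
    rw [hcc]; linarith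
  obtain ⟨y, hy, hyA, hyb⟩ := Literature.Analysis.Convex.LPDuality.affine_farkas A b cc hP hδ
  -- read off the multipliers
  refine ⟨fun i' => y (Sum.inl (Sum.inr i')) - y (Sum.inl (Sum.inl i')), ?_, ?_, ?_⟩
  · funext j'
    have h := congr_fun hyA (Sum.inl j')
    simp [A, cc, Matrix.vecMul, dotProduct, Fintype.sum_sum_type, Matrix.of_apply] at h
    simp [Matrix.vecMul, dotProduct, sub_mul, Finset.sum_sub_distrib]
    linarith
  · intro j'
    have h := congr_fun hyA (Sum.inr j')
    simp [A, cc, Matrix.vecMul, dotProduct, Fintype.sum_sum_type, Matrix.of_apply] at h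
    have hy3 : 0 ≤ y (Sum.inr j') := hy (Sum.inr j')
    simp [Matrix.vecMul, dotProduct, sub_mul, Finset.sum_sub_distrib]
    linarith
  · have h := hyb
    simp [b, dotProduct, Fintype.sum_sum_type, Finset.sum_neg_distrib] at h
    simp [dotProduct, sub_mul, Finset.sum_sub_distrib]
    linarith

namespace KMR

/-! ### §6a the dictionary: tree MAX-CUT instances ↦ nonnegative weightings -/

/-- a binary-disequality constraint is satisfied iff its two variables get different values. -/
theorem sat_eq_bne {n : ℕ} (C : CSPConstraint 2 n maxCutPreds) (b : Fin n → Bool) :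
    C.sat b = (b (C.idx 0) != b (C.idx 1)) := by
  have h : C.pred = fun y => y 0 != y 1 := by
    have := C.pred_mem
    simpa [maxCutPreds] using this
  simp [CSPConstraint.sat, h]

/-- the weighting of ORDERED pairs read off a tree instance: `w i j = #{c : idx c = (i, j)} / M`. -/
noncomputable def instWeight {n : ℕ} (I : CSPInstance 2 n maxCutPreds) : Fin n → Fin n → ℝ :=
  fun i j => (∑ c : Fin I.M, if (I.cons c).idx 0 = i ∧ (I.cons c).idx 1 = j then (1 : ℝ) else 0) / I.M

theorem instWeight_nonneg {n : ℕ} (I : CSPInstance 2 n maxCutPreds) : ∀ i j, 0 ≤ instWeight I i j := by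
  intro i j
  unfold instWeight
  exact div_nonneg (Finset.sum_nonneg fun c _ => by split_ifs <;> norm_num) (Nat.cast_nonneg _)

theorem sum_sum_ite_and_eq {n : ℕ} (f : Fin n → Fin n → ℝ) (i₀ j₀ : Fin n) :
    (∑ i, ∑ j, if i₀ = i ∧ j₀ = j then f i j else 0) = f i₀ j₀ := by
  have inner : ∀ i, (∑ j, if i₀ = i ∧ j₀ = j then f i j else 0) = if i₀ = i then f i j₀ else 0 := by
    intro i
    by_cases hi : i₀ = i <;> simp [hi]
  simp_rw [inner]
  simp

/-- `cutValue (instWeight I) b = I.val b`. -/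
theorem cutValue_instWeight {n : ℕ} (I : CSPInstance 2 n maxCutPreds) (b : Fin n → Bool) :
    cutValue (instWeight I) b = I.val b := by
  classical
  set g : Fin n → Fin n → ℝ := fun i j => if b i = b j then 0 else 1 with hg
  have hR : I.val b = (∑ c : Fin I.M, g ((I.cons c).idx 0) ((I.cons c).idx 1)) / I.M := by
    unfold CSPInstance.val
    congr 1
    refine Finset.sum_congr rfl fun c _ => ?_
    rw [sat_eq_bne]
    by_cases hc : b ((I.cons c).idx 0) = b ((I.cons c).idx 1)
    · simp [hg, hc]
    · simp [hg, hc]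
  have h1 : ∀ i j, (if b i = b j then (0 : ℝ) else
        (∑ c : Fin I.M, if (I.cons c).idx 0 = i ∧ (I.cons c).idx 1 = j then (1 : ℝ) else 0) / I.M) =
      (∑ c : Fin I.M, if (I.cons c).idx 0 = i ∧ (I.cons c).idx 1 = j then g i j else 0) / I.M := by
    intro i j
    by_cases hij : b i = b j
    · simp [hij, hg]
    · simp [hij, hg]
  have hL : cutValue (instWeight I) b =
      (∑ i, ∑ j, ∑ c : Fin I.M, if (I.cons c).idx 0 = i ∧ (I.cons c).idx 1 = j then g i j else 0) / I.M := by
    unfold cutValue instWeight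
    simp_rw [h1]
    simp only [← Finset.sum_div]
  rw [hL, hR]
  congr 1
  calc (∑ i, ∑ j, ∑ c : Fin I.M, if (I.cons c).idx 0 = i ∧ (I.cons c).idx 1 = j then g i j else 0)
      = ∑ i, ∑ c : Fin I.M, ∑ j, (if (I.cons c).idx 0 = i ∧ (I.cons c).idx 1 = j then g i j else 0) :=
        Finset.sum_congr rfl fun i _ => Finset.sum_comm
    _ = ∑ c : Fin I.M, ∑ i, ∑ j, (if (I.cons c).idx 0 = i ∧ (I.cons c).idx 1 = j then g i j else 0) :=
        Finset.sum_comm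
    _ = ∑ c : Fin I.M, g ((I.cons c).idx 0) ((I.cons c).idx 1) :=
        Finset.sum_congr rfl fun c _ => sum_sum_ite_and_eq g _ _

/-- `maxCutValue (instWeight I) = I.opt`. -/
theorem maxCutValue_instWeight {n : ℕ} (I : CSPInstance 2 n maxCutPreds) : maxCutValue (instWeight I) = I.opt := by
  unfold maxCutValue CSPInstance.opt
  exact Finset.sup'_congr _ rfl fun b _ => cutValue_instWeight I b

/-! ### §6b the asymptotic bookkeeping: `2^{n^{c₃}} ≤ 3R + 2n² + 4 ⟹ 2^{n^{c₃/2}} ≤ R` eventually -/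

theorem rpow_nat_eq (a : ℝ) (k : ℕ) : a ^ ((k : ℕ) : ℝ) = a ^ k := Real.rpow_natCast a k

/-- for `n` large (in terms of `c₃ > 0`): if `2^{n^{c₃}} ≤ 3R + 2n² + 4` then `2^{n^{c₃/2}} ≤ R`. -/
theorem two_rpow_half_le_of_bound {c₃ : ℝ} (hc₃ : 0 < c₃) :
    ∃ n₁ : ℕ, ∀ n ≥ n₁, ∀ R : ℕ,
      (2 : ℝ) ^ ((n : ℝ) ^ c₃) ≤ 3 * (R : ℝ) + 2 * (n : ℝ) ^ 2 + 4 → (2 : ℝ) ^ ((n : ℝ) ^ (c₃ / 2)) ≤ R := by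
  have hc : 0 < c₃ / 2 := by positivity
  obtain ⟨h₀, hh₀⟩ := polylog_lt_rpow_eventually 1 hc
  refine ⟨max h₀ 8, fun n hn R hB => ?_⟩
  have hn0 : h₀ ≤ n := le_trans (le_max_left _ _) hn
  have hn8 : 8 ≤ n := le_trans (le_max_right _ _) hn
  set x : ℝ := (n : ℝ) ^ (c₃ / 2) with hx
  set y : ℝ := (2 : ℝ) ^ x with hy
  -- `log₂ n + 1 < x`, hence `4 ≤ x` (as `n ≥ 8`) and `n < 2^x = y`
  have hlog : (((Nat.log 2 n + 1 : ℕ)) : ℝ) < x := by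
    have := hh₀ n hn0
    simpa using this
  have hk3 : 3 ≤ Nat.log 2 n := Nat.le_log_of_pow_le (by norm_num) (by simpa using hn8)
  have hx4 : 4 ≤ x := by
    have h4 : ((4 : ℕ) : ℝ) ≤ ((Nat.log 2 n + 1 : ℕ) : ℝ) := by exact_mod_cast (by omega : 4 ≤ Nat.log 2 n + 1)
    have hlog' := hlog
    push_cast at h4 hlog' ⊢
    linarith
  have hx0 : 0 ≤ x := by linarith
  have hny : (n : ℝ) < y := by
    have h1 : n < 2 ^ (Nat.log 2 n + 1) := Nat.lt_pow_succ_log_self (by norm_num) n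
    have h2 : (n : ℝ) < (2 : ℝ) ^ (((Nat.log 2 n + 1 : ℕ)) : ℝ) := by
      rw [rpow_nat_eq]; exact_mod_cast h1
    exact h2.trans (Real.rpow_lt_rpow_of_exponent_lt one_lt_two hlog)
  have hy16 : 16 ≤ y := by
    have h := Real.rpow_le_rpow_of_exponent_le one_le_two hx4
    have h4 : (2 : ℝ) ^ (4 : ℝ) = 16 := by
      rw [show (4 : ℝ) = ((4 : ℕ) : ℝ) by norm_num, rpow_nat_eq]; norm_num
    rw [h4] at h
    exact h
  have hn2 : (n : ℝ) ^ 2 < y ^ 2 := by nlinarith [hny, Nat.cast_nonneg (α := ℝ) n]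
  -- the exponent algebra: `8 y² = 2^{2x+3} ≤ 2^{x²} = 2^{n^{c₃}}`
  have hy2 : y ^ 2 = (2 : ℝ) ^ (2 * x) := by
    rw [hy, mul_comm, Real.rpow_mul (by norm_num : (0 : ℝ) ≤ 2), Real.rpow_two]
  have h8y2 : 8 * y ^ 2 = (2 : ℝ) ^ (2 * x + 3) := by
    rw [Real.rpow_add (by norm_num : (0 : ℝ) < 2), ← hy2,
      show (3 : ℝ) = ((3 : ℕ) : ℝ) by norm_num, rpow_nat_eq]
    norm_num; ring
  have hx2 : x ^ 2 = (n : ℝ) ^ c₃ := by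
    rw [hx, ← Real.rpow_two, ← Real.rpow_mul (Nat.cast_nonneg n)]
    congr 1; ring
  have hexp : 2 * x + 3 ≤ x ^ 2 := by nlinarith [hx4]
  have htop : (2 : ℝ) ^ (2 * x + 3) ≤ (2 : ℝ) ^ ((n : ℝ) ^ c₃) := by
    rw [← hx2]; exact Real.rpow_le_rpow_of_exponent_le one_le_two hexp
  -- contradiction if `R < y`
  by_contra hR
  push_neg at hR
  have hlt : 3 * (R : ℝ) + 2 * (n : ℝ) ^ 2 + 4 < 8 * y ^ 2 := by nlinarith [hR, hn2, hy16]
  linarith [hB, hlt, h8y2 ▸ htop]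

/-! ### §6c the bridge theorem -/

/-- ★★★ **`KMR.MaxCutLPGapHard` HOLDS** — from the tree theorem `KothariMekaRaghavendra2017_cor15_maxCut_holds` through
the size dictionary (slack-form lift ↦ CLRS nonnegative-factorisation LP, `NnrLp.relaxation`). [derived in the tree:
KothariMekaRaghavendra2017 Cor. 1.5; ChanLeeRaghavendraSteurer2016 Thm 2.3; LP duality] -/
theorem maxCutLPGapHard_holds : MaxCutLPGapHard := by
  intro ε hε
  obtain ⟨c₃, hc₃, n₀, hn₀⟩ := KothariMekaRaghavendra2017_cor15_maxCut_holds (ε / 2) (by linarith)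
  obtain ⟨n₁, hn₁⟩ := two_rpow_half_le_of_bound hc₃
  refine ⟨c₃ / 2, by positivity, max n₀ n₁, fun n hn D _ L R hG hS => ?_⟩
  classical
  have hn0 : n₀ ≤ n := le_trans (le_max_left _ _) hn
  have hn1 : n₁ ≤ n := le_trans (le_max_right _ _) hn
  -- the size-`R` slack-form lift of the feasible region and one slack vector per cut
  obtain ⟨Q, hQ⟩ := hS
  have hsl : ∀ b : Fin n → Bool, ∃ y : Fin R → ℝ, (∀ j, 0 ≤ y j) ∧ Q.E *ᵥ L.pt b + Q.F *ᵥ y = Q.g := by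
    intro b
    have hb : L.pt b ∈ Q.projSet := by rw [hQ]; exact L.contains b
    exact hb
  choose ys hys0 hysE using hsl
  obtain ⟨V, hV, hVdef⟩ : ∃ V : Fin R → (Fin n → Bool) → ℝ, (∀ l b, 0 ≤ V l b) ∧ ∀ l b, V l b = ys b l :=
    ⟨fun l b => ys b l, fun l b => hys0 b l, fun l b => rfl⟩
  have hne : Q.projSet.Nonempty := ⟨L.pt fun _ => false, by rw [hQ]; exact L.contains _⟩
  -- per instance: a nonnegative factorisation of `c' − I.val` through the slack coordinates, `c' ≤ (2−ε)·opt`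
  have hcert : ∀ I : CSPInstance 2 n maxCutPreds, ∃ (c' : ℝ) (U : Fin R → ℝ),
      (∀ l, 0 ≤ U l) ∧ c' ≤ (2 - ε) * I.opt ∧ ∀ b, c' - I.val b = ∑ l, U l * V l b := by
    intro I
    have hwnn : ∀ i j, 0 ≤ instWeight I i j := instWeight_nonneg I
    have hval : ∀ u ∈ Q.projSet, 0 ≤ (2 - ε) * maxCutValue (instWeight I) + (-L.obj (instWeight I)) ⬝ᵥ u := by
      intro u hu
      have hu' : u ∈ L.feasible := by rw [← hQ]; exact hu
      have := hG (instWeight I) hwnn u hu'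
      rw [neg_dotProduct]; linarith
    obtain ⟨μ, hE, hF, hg⟩ :=
      liftCertificate Q (-L.obj (instWeight I)) _ hne hval
    refine ⟨-(μ ⬝ᵥ Q.g), fun l => -((μ ᵥ* Q.F) l), fun l => by linarith [hF l], ?_, fun b => ?_⟩
    · rw [maxCutValue_instWeight] at hg
      linarith
    · have h1 : L.obj (instWeight I) ⬝ᵥ L.pt b = I.val b := by
        rw [L.consistent (instWeight I) hwnn b, cutValue_instWeight]
      have h2 : L.obj (instWeight I) ⬝ᵥ L.pt b = -(μ ⬝ᵥ (Q.E *ᵥ L.pt b)) := by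
        have : L.obj (instWeight I) = -(μ ᵥ* Q.E) := by rw [← hE, neg_neg]
        rw [this, neg_dotProduct, Matrix.dotProduct_mulVec]
      have h3 : Q.E *ᵥ L.pt b = Q.g - Q.F *ᵥ ys b := by rw [← hysE b]; simp
      rw [h2, h3, dotProduct_sub, Matrix.dotProduct_mulVec] at h1
      have h4 : (∑ l, -((μ ᵥ* Q.F) l) * V l b) = -((μ ᵥ* Q.F) ⬝ᵥ ys b) := by
        simp only [hVdef, dotProduct, neg_mul, Finset.sum_neg_distrib]
      rw [h4]
      linarith
  -- the CLRS relaxation of the tree built on `V` achieves ratio `2 − ε`, hence has gap `< 2 − ε/2`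
  have hAR : (Literature.Combinatorics.Optimization.NnrLp.relaxation (k := 2) (P := maxCutPreds) (V := V) hV).AchievesRatio
      (2 - ε) := by
    intro I y hy
    have hfe : Literature.Combinatorics.Optimization.NnrLp.Feasible 2 V y := by
      intro ρ
      have h : Literature.Combinatorics.Optimization.NnrLp.rowVec 2 V
            ((Literature.Combinatorics.Optimization.NnrLp.eR (k := 2) (V := V)).symm
              (Literature.Combinatorics.Optimization.NnrLp.eR (k := 2) (V := V) ρ)) ⬝ᵥ y ≤
          Literature.Combinatorics.Optimization.NnrLp.rhs 2 V
            ((Literature.Combinatorics.Optimization.NnrLp.eR (k := 2) (V := V)).symm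
              (Literature.Combinatorics.Optimization.NnrLp.eR (k := 2) (V := V) ρ)) :=
        hy (Literature.Combinatorics.Optimization.NnrLp.eR (k := 2) (V := V) ρ)
      rwa [Equiv.symm_apply_apply] at h
    obtain ⟨c', U, hU, hc', hfac⟩ := hcert I
    exact (hfe.val_le hU hfac).trans hc'
  have hGap : (Literature.Combinatorics.Optimization.NnrLp.relaxation (k := 2) (P := maxCutPreds) (V := V) hV).GapLT
      (2 - ε / 2) := ⟨2 - ε, by linarith, hAR⟩
  -- KMR Cor. 1.5 (tree) forces the CLRS relaxation to be large; its size is `≤ 3R + 2n² + 4`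
  have hsize : (2 : ℝ) ^ ((n : ℝ) ^ c₃) ≤
      (Literature.Combinatorics.Optimization.NnrLp.size (k := 2) (V := V) : ℝ) := by
    by_contra hlt
    push_neg at hlt
    exact hn₀ n hn0 _ hlt _ hGap
  have hle : (Literature.Combinatorics.Optimization.NnrLp.size (k := 2) (V := V) : ℝ) ≤
      3 * (R : ℝ) + 2 * (n : ℝ) ^ 2 + 4 := by
    exact_mod_cast Literature.Combinatorics.Optimization.NnrLp.size_le (k := 2) (V := V)
  exact hn₁ n hn1 R (hsize.trans hle)

end KMR

/-! ### §6d hypothesis-free consequences: `MaxCutLPApproxHard`, `MaxCutLPHard`, classes K and K_θ DECIDED -/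

/-- ★★★ `MaxCutLPApproxHard` HOLDS (the statement of the line's KNOWN stub `stub_maxCutLPApproxHard`). -/
theorem maxCutLPApproxHard_holds : MaxCutLPApproxHard :=
  maxCutLPApproxHard_of_kmr KMR.maxCutLPGapHard_holds

/-- ★★★ `MaxCutLPHard` HOLDS. -/
theorem maxCutLPHard_holds : MaxCutLPHard :=
  maxCutLPHard_of_kmr KMR.maxCutLPGapHard_holds

/-- ★★★ **CLASS K IS DECIDED (unconditionally)**: cut-dominant passengers — `Z_full`, every 0-1 rank-one tower, every
zonotope with cut-nonnegative generators — do not make `COR(K_h) + Q` quasi-polynomially cheap. -/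
theorem cutDominant_decided_holds :
    ∀ c : ℕ, ∃ h₀ : ℕ, ∀ h ≥ h₀, ∀ (K : ℕ) (q : Fin (K + 1) → (Fin h × Fin h → ℝ)) (r : ℕ),
      CutDominant h q →
      HasEFOfSize (corPolytopeGraph (⊤ : SimpleGraph (Fin h)) + convexHull ℝ (Set.range q)) r → T c h < r :=
  cutDominant_decided maxCutLPHard_holds

/-- ★★★ **CLASS K_θ IS DECIDED (unconditionally, every `θ < 1`)**. -/
theorem gapThin_decided_holds (θ : ℝ) (hθ : θ < 1) :
    ∀ c : ℕ, ∃ h₀ : ℕ, ∀ h ≥ h₀, ∀ (K : ℕ) (q : Fin (K + 1) → (Fin h × Fin h → ℝ)) (r : ℕ),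
      GapThin θ h q →
      HasEFOfSize (corPolytopeGraph (⊤ : SimpleGraph (Fin h)) + convexHull ℝ (Set.range q)) r → T c h < r :=
  gapThin_decided maxCutLPApproxHard_holds θ hθ

end Unconditional

end Summit.ValiantsHypothesis.ValiantsHypothesis.Cruxes.NNDivisionHard.MaxCutLP
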